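import Mathlib
import Summits.ValiantsHypothesis.ValiantsHypothesis.Theorems.LacunarySymmetroidMatrixDescartesCensusRealExponentsSignVar

/-!
# `MatrixDescartes` census — elementary kit for the `2 × 2` non-sharp real-exponent transfer

HONEST FRAMING.  Object-search cell `pub-symmetroid`, item `DoorA26 = PosRootLawAt 2 6 19`
(stmt-ValiantsHypothesis-19979; OPEN, typed, never asserted); this file contains only ELEMENTARY
helpers (a perturbation matrix, a gap lemma, a majority lemma, a point sequence, a root-avoidance
lemma, four sign manipulations) consumed by `…CensusRealExponentsTwoByTwo`
(`posRootLawAt_two_iff_rpow`).  Nothing here bears on `MatrixDescartes` (stmt-ValiantsHypothesis-18050)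
or `VP ≠ VNP`.

[folklore] Elementary.
-/

-- `Summit.ValiantsHypothesis.ValiantsHypothesis.…` repeats a component by the D-0017 layout
-- (single-conjunct summit), which the `dupNamespace` linter flags; the name is mandated.
set_option linter.dupNamespace false

namespace Summit.ValiantsHypothesis.ValiantsHypothesis.Theorems.LacunarySymmetroidMatrixDescartes.Census.RealExp

open Finset Polynomial
open scoped BigOperators Matrix

section TwoByTwoKit

/-- The symmetric `2 × 2` matrix `[[1, c],[c, c² + s]]` is symmetric. [folklore] -/
theorem isSymm_pertMatrix (c s : ℝ) : (!![1, c; c, c ^ 2 + s] : Matrix (Fin 2) (Fin 2) ℝ).IsSymm := by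
  ext i j; fin_cases i <;> fin_cases j <;> rfl

/-- `det [[1, c],[c, c² + s]] = s`. [folklore] -/
theorem det_pertMatrix (c s : ℝ) : (!![1, c; c, c ^ 2 + s] : Matrix (Fin 2) (Fin 2) ℝ).det = s := by
  rw [Matrix.det_fin_two_of]; ring

/-- A third of the minimal gap of a strictly increasing finite family. [folklore] -/
theorem exists_third_gap {n : ℕ} (g : Fin n → ℝ) (hg : StrictMono g) :
    ∃ η : ℝ, 0 < η ∧ ∀ i j : Fin n, i < j → 3 * η ≤ g j - g i := by
  classical
  set P : Finset (Fin n × Fin n) := univ.filter (fun q => q.1 < q.2) with hP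
  by_cases hPe : P.Nonempty
  · set D : Finset ℝ := P.image (fun q => g q.2 - g q.1) with hD
    have hDne : D.Nonempty := hPe.image _
    set m0 := D.min' hDne with hm0
    have hm0pos : 0 < m0 := by
      have hmem := D.min'_mem hDne
      rw [← hm0, hD, Finset.mem_image] at hmem
      obtain ⟨q, hq, hqm⟩ := hmem
      rw [hP, Finset.mem_filter] at hq
      rw [← hqm]; exact sub_pos.mpr (hg hq.2)
    refine ⟨m0 / 3, by positivity, fun i j hij => ?_⟩
    have hmem : g j - g i ∈ D := by
      rw [hD, Finset.mem_image]
      exact ⟨(i, j), by rw [hP, Finset.mem_filter]; exact ⟨mem_univ _, hij⟩, rfl⟩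
    have := D.min'_le _ hmem
    linarith
  · exact ⟨1, one_pos, fun i j hij =>
      absurd ⟨(i, j), by rw [hP, Finset.mem_filter]; exact ⟨mem_univ _, hij⟩⟩ hPe⟩

/-- **Majority of signs.**  For non-zero values `v` on a finite set `A`, one of the two signs
`s = ±1` makes `s · v a < 0` for at least half of the `a ∈ A`. [folklore] -/
theorem exists_sign_majority {α : Type*} [DecidableEq α] (A : Finset α) (v : α → ℝ)
    (hv : ∀ a ∈ A, v a ≠ 0) :
    ∃ s : ℝ, (s = 1 ∨ s = -1) ∧ A.card ≤ 2 * (A.filter (fun a => s * v a < 0)).card := by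
  classical
  by_cases hc : A.card ≤ 2 * (A.filter (fun a => v a < 0)).card
  · refine ⟨1, Or.inl rfl, ?_⟩
    have : A.filter (fun a => (1 : ℝ) * v a < 0) = A.filter (fun a => v a < 0) := by
      congr 1; ext a; rw [one_mul]
    rw [this]; exact hc
  · refine ⟨-1, Or.inr rfl, ?_⟩
    have hsplit : (A.filter (fun a => v a < 0)).card + (A.filter (fun a => ¬ v a < 0)).card = A.card :=
      Finset.card_filter_add_card_filter_not _
    have hsub : A.filter (fun a => ¬ v a < 0) ⊆ A.filter (fun a => (-1 : ℝ) * v a < 0) := by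
      intro a ha
      rw [Finset.mem_filter] at ha ⊢
      refine ⟨ha.1, ?_⟩
      rcases lt_trichotomy (v a) 0 with h | h | h
      · exact absurd h ha.2
      · exact absurd h (hv a ha.1)
      · linarith
    have := Finset.card_le_card hsub
    push Not at hc
    omega

/-- **The point sequence `ρ₁ < g₁ < λ₁ < ρ₂ < ⋯`.**  For a strictly increasing `g : Fin n → ℝ`
(`n ≥ 1`) and `η > 0` with `3η ≤` every gap, there is a strictly increasing `P : ℕ → ℝ` with
`P(3j) = g_j − η`, `P(3j+1) = g_j`, `P(3j+2) = g_j + η`. [folklore] -/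
theorem exists_pointSeq {n : ℕ} (hn : 0 < n) (g : Fin n → ℝ) (hg : StrictMono g) {η : ℝ} (hη : 0 < η)
    (hgap : ∀ i j : Fin n, i < j → 3 * η ≤ g j - g i) :
    ∃ P : ℕ → ℝ, StrictMono P ∧ ∀ j : Fin n,
      P (3 * j) = g j - η ∧ P (3 * j + 1) = g j ∧ P (3 * j + 2) = g j + η := by
  set Pt : ℕ → ℝ := fun i => if h : i / 3 < n then
      (if i % 3 = 0 then g ⟨i / 3, h⟩ - η else if i % 3 = 1 then g ⟨i / 3, h⟩ else g ⟨i / 3, h⟩ + η)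
    else g ⟨n - 1, by omega⟩ + η + i with hPt
  have hPt0 : ∀ j : Fin n, Pt (3 * j) = g j - η := by
    intro j
    have h1 : 3 * (j : ℕ) / 3 = j := by omega
    have h2 : 3 * (j : ℕ) % 3 = 0 := by omega
    simp only [hPt, h1, h2, j.isLt, dite_true, if_true, Fin.eta]
  have hPt1 : ∀ j : Fin n, Pt (3 * j + 1) = g j := by
    intro j
    have h1 : (3 * (j : ℕ) + 1) / 3 = j := by omega
    have h2 : (3 * (j : ℕ) + 1) % 3 = 1 := by omega
    simp only [hPt, h1, h2, j.isLt, dite_true, if_true, one_ne_zero, if_false, Fin.eta]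
  have hPt2 : ∀ j : Fin n, Pt (3 * j + 2) = g j + η := by
    intro j
    have h1 : (3 * (j : ℕ) + 2) / 3 = j := by omega
    have h2 : (3 * (j : ℕ) + 2) % 3 = 2 := by omega
    simp only [hPt, h1, h2, j.isLt, dite_true, Fin.eta]
    norm_num
  have hPt_succ : ∀ i : ℕ, Pt i < Pt (i + 1) := by
    intro i
    by_cases hi : i / 3 < n
    · set j : Fin n := ⟨i / 3, hi⟩ with hj
      have hr : i % 3 = 0 ∨ i % 3 = 1 ∨ i % 3 = 2 := by omega
      rcases hr with hr | hr | hr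
      · have e1 : i = 3 * (j : ℕ) := by simp only [hj]; omega
        rw [e1, hPt0 j, hPt1 j]; linarith
      · have e1 : i = 3 * (j : ℕ) + 1 := by simp only [hj]; omega
        rw [e1, hPt1 j, show 3 * (j : ℕ) + 1 + 1 = 3 * (j : ℕ) + 2 by ring, hPt2 j]; linarith
      · have e1 : i = 3 * (j : ℕ) + 2 := by simp only [hj]; omega
        rw [e1, hPt2 j, show 3 * (j : ℕ) + 2 + 1 = 3 * ((j : ℕ) + 1) by ring]
        by_cases hj1 : (j : ℕ) + 1 < n
        · set j' : Fin n := ⟨(j : ℕ) + 1, hj1⟩ with hj'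
          have := hPt0 j'
          simp only [hj'] at this
          rw [this]
          have hlt : j < j' := by rw [Fin.lt_def]; simp [hj']
          have := hgap j j' hlt
          linarith
        · have hout : ¬ (3 * ((j : ℕ) + 1)) / 3 < n := by omega
          simp only [hPt, hout, dite_false]
          have hjlast : g j ≤ g ⟨n - 1, by omega⟩ := hg.monotone (by
            rw [Fin.le_def]; simp only []; omega)
          have : (0 : ℝ) ≤ (3 * ((j : ℕ) + 1) : ℕ) := by positivity
          push_cast at this ⊢
          linarith
    · have hout1 : ¬ (i + 1) / 3 < n := by omega
      simp only [hPt, hi, hout1, dite_false]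
      push_cast; linarith
  exact ⟨Pt, strictMono_nat_of_lt_succ hPt_succ, fun j => ⟨hPt0 j, hPt1 j, hPt2 j⟩⟩

/-- **Avoiding finitely many roots.**  For a finite family of non-zero real polynomials there is a real
number at which none of them vanishes. [folklore] -/
theorem exists_eval_ne_zero {ι : Type*} (A : Finset ι) (Q : ι → ℝ[X]) (hQ : ∀ j ∈ A, Q j ≠ 0) :
    ∃ c : ℝ, ∀ j ∈ A, (Q j).eval c ≠ 0 := by
  classical
  obtain ⟨c, hc⟩ : ∃ c : ℝ, c ∉ A.biUnion (fun j => (Q j).roots.toFinset) :=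
    Infinite.exists_notMem_finset _
  refine ⟨c, fun j hj h0 => hc ?_⟩
  rw [Finset.mem_biUnion]
  refine ⟨j, hj, ?_⟩
  rw [Multiset.mem_toFinset, mem_roots (hQ j hj)]
  exact h0

/-- The quadratic `a X² + b X + d` is zero only if `a = b = d = 0`. [folklore] -/
theorem quadratic_eq_zero {a b d : ℝ} (h : C a * X ^ 2 + C b * X + C d = (0 : ℝ[X])) :
    a = 0 ∧ b = 0 ∧ d = 0 := by
  have h2 : (C a * X ^ 2 + C b * X + C d).coeff 2 = a := by
    simp [coeff_add, coeff_C_mul, coeff_X_pow]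
  have h1 : (C a * X ^ 2 + C b * X + C d).coeff 1 = b := by
    simp [coeff_add, coeff_C_mul, coeff_X_pow, coeff_C]
  have h0 : (C a * X ^ 2 + C b * X + C d).coeff 0 = d := by
    simp [coeff_add, coeff_X_pow, coeff_X, coeff_C]
  rw [h, coeff_zero] at h2 h1 h0
  exact ⟨h2.symm, h1.symm, h0.symm⟩

/-- Sign bookkeeping (i): `a'` has the sign of `a`, `b'` the opposite sign ⇒ `a' b' < 0`. [folklore] -/
theorem mul_neg_of_keep_of_flip {a a' b' : ℝ} (h1 : 0 < a' * a) (h2 : b' * a < 0) : a' * b' < 0 := by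
  have h3 : a * a * (a' * b') < 0 := by
    have h4 := mul_neg_of_neg_of_pos h2 h1
    have e : b' * a * (a' * a) = a * a * (a' * b') := by ring
    rwa [e] at h4
  exact neg_of_mul_neg_right h3 (mul_self_nonneg _)

/-- Sign bookkeeping (ii): `c'` has the sign of `c`, `b'` the sign opposite to `a`, and `a c > 0` ⇒
`b' c' < 0`. [folklore] -/
theorem mul_neg_of_keep_of_flip' {a c b' c' : ℝ} (h1 : 0 < c' * c) (h2 : b' * a < 0) (h3 : 0 < a * c) :
    b' * c' < 0 := by
  have h4 : a * c * (b' * c') < 0 := by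
    have h5 := mul_neg_of_neg_of_pos h2 h1
    have e : b' * a * (c' * c) = a * c * (b' * c') := by ring
    rwa [e] at h5
  exact neg_of_mul_neg_right h4 h3.le

/-- Sign bookkeeping (iii): `a'`, `c'` have the signs of `a`, `c` and `a c < 0` ⇒ `a' c' < 0`.
[folklore] -/
theorem mul_neg_of_keep_keep {a c a' c' : ℝ} (h1 : 0 < a' * a) (h3 : 0 < c' * c) (hneg : a * c < 0) :
    a' * c' < 0 := by
  have h5 : 0 < a' * c' * (a * c) := by
    have := mul_pos h1 h3
    have e : a' * a * (c' * c) = a' * c' * (a * c) := by ring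
    rwa [e] at this
  by_contra h6
  push Not at h6
  have : a' * c' * (a * c) ≤ 0 := mul_nonpos_of_nonneg_of_nonpos h6 hneg.le
  linarith

/-- Sign bookkeeping (iv): if `a' c' < 0`, `b' ≠ 0` and `a' b' ≥ 0` then `b' c' < 0` (of the two
consecutive products at least one is negative). [folklore] -/
theorem mul_neg_of_not_first {a' b' c' : ℝ} (hrl : a' * c' < 0) (hb : b' ≠ 0) (hcase : 0 ≤ a' * b') :
    b' * c' < 0 := by
  have hsq : 0 < b' * b' := mul_self_pos.mpr hb
  by_contra h7
  push Not at h7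
  have h8 : 0 ≤ a' * b' * (b' * c') := mul_nonneg hcase h7
  have e2 : a' * b' * (b' * c') = b' * b' * (a' * c') := by ring
  rw [e2] at h8
  have h9 : b' * b' * (a' * c') < 0 := mul_neg_of_pos_of_neg hsq hrl
  linarith

end TwoByTwoKit

end Summit.ValiantsHypothesis.ValiantsHypothesis.Theorems.LacunarySymmetroidMatrixDescartes.Census.RealExp
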